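import Literature.InformationTheory.QuantumCodes.QuantumExpanderThresholdMinMax
import HarnessLib

/-!
# Robustness of quantum expander codes (the shape of LTZ15 Cor 9) from the `β`-decoder: PROOF

Index of sources: `[cite: LeverrierTillichZemor2015]` = Leverrier–Tillich–Zémor, FOCS 2015 / arXiv:1504.00822v1, Cor 9
"Robustness" (p0009 L9-11: "Any error `e` with reduced weight `w_R(e) < min(γ_A n_A, γ_B n_B)` has a syndrome with
weight bounded from below as `|σ(e)| ≥ w_R(e)/3`"); `[cite: FawziGrospellierLeverrier2018]` = Fawzi–Grospellier–Leverrier,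
arXiv:1711.08351v2, proof of Prop 11 (§7.1, p0018 L131 – p0019 L4: "`β d_B Σ|F_i| ≤ |σ_X(E_0)| − |σ_X(E_f)|`").

qec PARTITION v2 row 04 (`prover-qec-type-04`, gen 5). Context: the printed proof of LTZ15 Cor 9 rests on clause (ii) of
Lemma 8, whose case-4 step has a normalisation gap for `Δ_A ≠ Δ_B` (qec FINDINGS E-7; nothing in the tree used it). This
file proves a robustness statement OF THE SAME SHAPE by a different, gap-free route — the syndrome-weight accounting of
FGL18's `β`-decoder (Prop 11, convention-free form `add_runOutput_mem_rowSpace_minmax`, and the run invariant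
`ssfRun_invariants`): for a `(Δ_A,Δ_B)`-biregular `(γ_A,δ_A,γ_B,δ_B)`-expander with `β̃ = betaZero (min Δ) (max Δ) δ_A δ_B > 0`,
EVERY error `e` whose coset `e + C_Z^⊥` contains a word of weight `≤ (min Δ/max Δ)(β̃/(1+β̃))·min(γ_A n_A, γ_B n_B)`
has `|σ_X(e)| ≥ β̃·max(Δ_A,Δ_B)·w_R(e)`, phrased without a `w_R` definition as: some `e' ≡ e (mod C_Z^⊥)` has
`β̃·max Δ·|e'| ≤ |σ_X(e)|`.

* `syndrome_weight_ge_beta_reducedWeight` — the statement above (`X`-sector).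

HONEST FRAMING: this is NOT the printed Cor 9 (constant `1/3`, radius `min(γ_A n_A, γ_B n_B)`, hypothesis `δ < 1/6`):
the constant here is `β̃·max Δ` (larger than `1/3` as soon as `min Δ·(1 − 4(δ_A+δ_B+(δ_B−δ_A)²)) ≥ 2/3`), the radius is
the Prop-11 radius (smaller by the factor `(min Δ/max Δ)·β̃/(1+β̃)`), and `β̃ > 0` needs `δ_A + δ_B + (δ_B−δ_A)² < 1/4`.
PROVED (kernel axioms); no definitions, no named facts.
-/

namespace Literature.InformationTheory.QuantumCodes

namespace QuantumExpander

open Finset Matrix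

variable {A B : Type*} [Fintype A] [Fintype B] [DecidableEq A] [DecidableEq B]

/-- **Robustness of quantum expander codes, `β`-decoder form** (the shape of LTZ15 Cor 9, proved through FGL18 Prop 11):
if the coset `e + C_Z^⊥` of an `X`-error `e` contains a word `e₀` of weight
`≤ (min Δ/max Δ)·(β̃/(1+β̃))·min(γ_A n_A, γ_B n_B)`, then some word `e'` of that coset satisfies
`β̃·max(Δ_A,Δ_B)·|e'| ≤ |σ_X(e)|` — i.e. `|σ_X(e)| ≥ β̃·max Δ·w_R(e)`. Proof: run ANY complete `β̃·max Δ`-threshold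
small-set-flip run from `σ_X(e₀) = σ_X(e)`; by Prop 11 it ends with `e₀ ⊕ Ê ∈ C_Z^⊥`, so its final syndrome vanishes and
the run invariant gives `β̃·max Δ·|Ê| ≤ β̃·max Δ·Σ|F_i| ≤ |σ_X(e)|`, while `Ê ≡ e₀ ≡ e`.
[cite: LeverrierTillichZemor2015, Cor 9 (statement shape; arXiv v1 p0009 L9-11)] [cite: FawziGrospellierLeverrier2018, proof of Prop 11 (β d_B Σ|F_i| ≤ |σ_X(E_0)| − |σ_X(E_f)|; arXiv v2 p0019 L1-2)] -/
theorem syndrome_weight_ge_beta_reducedWeight (H : Matrix B A (ZMod 2)) {dA dB : ℕ} {γA δA γB δB : ℝ}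
    (hreg : IsBiregular H dA dB) (hexp : IsLeftRightExpanding H dA dB γA δA γB δB)
    (hdA : 0 < dA) (hdB : 0 < dB) (hδA : 0 < δA) (hδB : 0 < δB)
    (hβ : 0 < betaZero (min dA dB) (max dA dB) δA δB)
    {e e₀ : (A × A) ⊕ (B × B) → ZMod 2} (he₀ : e₀ + e ∈ rowSpace (expanderHZ H))
    (hw : (hammingNorm e₀ : ℝ) ≤
      ((min dA dB : ℕ) : ℝ) / ((max dA dB : ℕ) : ℝ) * betaZero (min dA dB) (max dA dB) δA δB
        / (1 + betaZero (min dA dB) (max dA dB) δA δB) * min (γA * Fintype.card A) (γB * Fintype.card B)) :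
    ∃ e' : (A × A) ⊕ (B × B) → ZMod 2, e' + e ∈ rowSpace (expanderHZ H) ∧
      betaZero (min dA dB) (max dA dB) δA δB * ((max dA dB : ℕ) : ℝ) * hammingNorm e'
        ≤ hammingNorm (expanderHX H *ᵥ e) := by
  classical
  set κ : ℝ := betaZero (min dA dB) (max dA dB) δA δB * ((max dA dB : ℕ) : ℝ) with hκdef
  -- a complete run from `σ_X(e₀)`
  obtain ⟨l, hrun⟩ := exists_isSSFRun κ (expanderHX H) (expanderHZ H) (expanderHX H *ᵥ e₀)
  -- Prop 11 on runs: the run corrects `e₀`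
  have hcorr : e₀ + runOutput l ∈ rowSpace (expanderHZ H) :=
    add_runOutput_mem_rowSpace_minmax H hreg hexp hdA hdB hδA hδB hβ hrun hw
  -- hence the final syndrome vanishes
  have hfinal : expanderHX H *ᵥ e₀ + expanderHX H *ᵥ runOutput l = 0 := by
    rw [← Matrix.mulVec_add]
    exact expanderHX_mulVec_eq_zero_of_mem_rowSpace H hcorr
  -- the run invariant: `κ Σ|F_i| ≤ |σ_X(e₀)| - |σ_f| = |σ_X(e₀)|`
  have hinv := (ssfRun_invariants hrun).2
  rw [hfinal, hammingNorm_zero, Nat.cast_zero, sub_zero] at hinv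
  -- `σ_X(e₀) = σ_X(e)` (they differ by a `Z`-stabilizer element)
  have hsyn : expanderHX H *ᵥ e₀ = expanderHX H *ᵥ e := by
    have h0 := expanderHX_mulVec_eq_zero_of_mem_rowSpace H he₀
    rw [Matrix.mulVec_add] at h0
    -- characteristic 2: `a + b = 0 → a = b`
    have : expanderHX H *ᵥ e₀ = -(expanderHX H *ᵥ e) := eq_neg_of_add_eq_zero_left h0
    rw [this]
    funext c
    simp only [Pi.neg_apply, ZMod.neg_eq_self_mod_two]
  refine ⟨runOutput l, ?_, ?_⟩
  · -- `Ê + e = (e₀ + Ê) + (e₀ + e)` in characteristic 2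
    have hsum : runOutput l + e = (e₀ + runOutput l) + (e₀ + e) := by
      funext q
      simp only [Pi.add_apply]
      have h2 : e₀ q + e₀ q = 0 := by
        rw [← two_mul]
        have : (2 : ZMod 2) = 0 := by decide
        rw [this, zero_mul]
      linear_combination -h2
    rw [hsum]
    exact Submodule.add_mem _ hcorr he₀
  · rw [← hsyn]
    refine le_trans ?_ hinv
    refine mul_le_mul_of_nonneg_left ?_ ?_
    · exact_mod_cast hammingNorm_runOutput_le l
    · rw [hκdef]
      exact mul_nonneg hβ.le (Nat.cast_nonneg _)

end QuantumExpander

end Literature.InformationTheory.QuantumCodes
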